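import Summits.HodgeConjecture.HodgeCM.Model.ArchKTypeOfFin_1

/-! PORT of `HodgeCM/Model/ArchKTypeOfFin.lean` (HodgeCMPerL run 82) — part 2: continuation of `Summits.HodgeConjecture.HodgeCM.Model.ArchKTypeOfFin_1` (split at a top-level declaration boundary by port_pkg.py; scope re-opened below; declarations unchanged). -/

-- port_pkg: scope re-opened for this part (file-level context, then the namespace/section stack open at the cut)
set_option autoImplicit false
noncomputable section
open Filter Topology Complex
open NumberField NumberField.InfinitePlace NumberField.mixedEmbedding IsDedekindDomain MeasureTheory
open scoped Matrix TensorProduct Classical SchwartzMap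
open MulAction
open Literature.Geometry.ComplexHyperbolic.BallModel (U21 x₀ stabilizerEquivK21)
open Literature.AlgebraicGeometry.HodgeTheory
open Literature.AlgebraicGeometry.ShimuraVarieties
open Literature.NumberTheory.Automorphic Literature.NumberTheory.Weil1964
open Literature.NumberTheory.GelbartRogawski1991 Literature.NumberTheory.GelbartRogawski1991.UnitaryDualPair
open Literature.NumberTheory.Automorphic.PicardCM
open HodgeCM.Adelic HodgeCM.PerL34 HodgeCM.Model.HypCensus HodgeCM.Model.SupplyInstance HodgeCM.Model.ArchSideTerm
namespace HodgeCM.Model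
section Family
variable
  (hGR : ∀ {L : CMField} {ι₁ : L →+* ℂ} (V : HermSpace3 L ι₁) (c : SeesawCtx L),
    (cmSplittingDatum (L : Type) finProdFinEquiv (frameD V) (frameD_real V) (frameD_ne V) (dW c.D) (dW_real c.D)
      (dW_ne c.D)).CompatibleSplitting)
  (η : ∀ {L : CMField} {ι₁ : L →+* ℂ} (V : HermSpace3 L ι₁) (c : SeesawCtx L),
    CMAdelic (L : Type) (frameD V) × CMAdelic (L : Type) (dW c.D) →* ℂˣ)
  (hηc : ∀ {L : CMField} {ι₁ : L →+* ℂ} (V : HermSpace3 L ι₁) (c : SeesawCtx L), Continuous fun p => ((η V c p : ℂˣ) : ℂ))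
  (hGR₀ : ∀ {L : CMField} {ι₁ : L →+* ℂ} (V : HermSpace3 L ι₁) (c : SeesawCtx L),
    (cmSplittingDatum (L : Type) (e₁) (frameD V) (frameD_real V) (frameD_ne V) (lineVec (L : Type) (dW c.D 0))
      (fun _ => dW_real c.D 0) (fun _ => dW_ne c.D 0)).CompatibleSplitting)
  (hGR₁ : ∀ {L : CMField} {ι₁ : L →+* ℂ} (V : HermSpace3 L ι₁) (c : SeesawCtx L),
    (cmSplittingDatum (L : Type) (e₁) (frameD V) (frameD_real V) (frameD_ne V) (lineVec (L : Type) (dW c.D 1))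
      (fun _ => dW_real c.D 1) (fun _ => dW_ne c.D 1)).CompatibleSplitting)
  (hGR₂ : ∀ {L : CMField} {ι₁ : L →+* ℂ} (V : HermSpace3 L ι₁) (c : SeesawCtx L),
    (cmSplittingDatum (L : Type) (e₁) (frameD V) (frameD_real V) (frameD_ne V) (lineVec (L : Type) (dW' c.D 0))
      (fun _ => dW'_real c.D 0) (fun _ => dW'_ne c.D 0)).CompatibleSplitting)
  (hGR₃ : ∀ {L : CMField} {ι₁ : L →+* ℂ} (V : HermSpace3 L ι₁) (c : SeesawCtx L),
    (cmSplittingDatum (L : Type) (e₁) (frameD V) (frameD_real V) (frameD_ne V) (lineVec (L : Type) (dW' c.D 1))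
      (fun _ => dW'_real c.D 1) (fun _ => dW'_ne c.D 1)).CompatibleSplitting)
  (μ : ∀ {L : CMField}, SeesawCtx L → Fin 4 → NumberField.InfinitePlace L → ℤ)
  (𝔄 : ∀ {L : CMField} {ι₁ : L →+* ℂ} (V : HermSpace3 L ι₁) (c : SeesawCtx L),
    ArchLineDatum V c.D (hGR V c) (hGR₀ V c) (hGR₁ V c) (hGR₂ V c) (hGR₃ V c) (η V c) (μ c))
variable {L : CMField} {ι₁ : L →+* ℂ} (V : HermSpace3 L ι₁) (c : SeesawCtx L)
/-- (Ported verbatim from the HodgeCMPerL package; no docstring in the source.) -/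
theorem finLevelIndex_ne_zero (N : ℕ) : finLevelIndex hGR η hηc hGR₀ hGR₁ hGR₂ hGR₃ μ 𝔄 V c N ≠ 0 := by
  unfold finLevelIndex
  split
  · exact mul_ne_zero (deepIndexZero_ne_zero V c.D _ _ _ _ _ _ _ N) (deepIndexOne_ne_zero V c.D _ _ _ _ _ _ N)
  · exact one_ne_zero

/-- (Ported verbatim from the HodgeCMPerL package; no docstring in the source.) -/
theorem finLevelIndex_of_pos (N : ℕ) (h : (∀ j, 0 < (ι₁ (dW c.D j)).re) ∨ ∀ j, (ι₁ (dW c.D j)).re < 0) :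
    finLevelIndex hGR η hηc hGR₀ hGR₁ hGR₂ hGR₃ μ 𝔄 V c N =
      deepIndexZero V c.D (hGR V c) (hGR₀ V c) (hGR₁ V c) (η V c) (hηc V c) h ((𝔄 V c).x₀ 0) N *
        deepIndexOne V c.D (hGR V c) (hGR₀ V c) (hGR₁ V c) (η V c) (hηc V c) ((𝔄 V c).x₀ 1) N := by
  rw [finLevelIndex, dif_pos h]

/-- **THE SUPPLY LEVEL FAMILY `Γ₀ V c N`** of #CA17 § 5 (DATA, total): the deep level at the index of the context. -/
def finLevelFamily : ∀ {L : CMField} {ι₁ : L →+* ℂ} (V : HermSpace3 L ι₁) (_c : SeesawCtx L) (_N : ℕ), Level V :=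
  fun V c N => deepLevel V (finLevelIndex hGR η hηc hGR₀ hGR₁ hGR₂ hGR₃ μ 𝔄 V c N)
    (finLevelIndex_ne_zero hGR η hηc hGR₀ hGR₁ hGR₂ hGR₃ μ 𝔄 V c N)

/-- **`hfin₀` OF #CA17 § 5 — DISCHARGED** (literal binder shape: guards `hemb`/`hc` carried; only the plane sign of `hc` is used). -/
theorem hfin_zero_family :
    ∀ {L : CMField} {ι₁ : L →+* ℂ} (V : HermSpace3 L ι₁) (c : SeesawCtx L) (hV : IsAnisotropic L V.Hm)
      (_hemb : (InfinitePlace.mk ι₁).embedding = ι₁) (_hc : SignRecipe.GoodCtx (orientBitι L ι₁) ι₁ c) (N : ℕ),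
    ∀ kf : UnitaryGroup.finAdelic (↥(maximalRealSubfield L)) L (IsCMField.complexConj L) 3 V.Hm,
      kf ∈ (finLevelFamily hGR η hηc hGR₀ hGR₁ hGR₂ hGR₃ μ 𝔄 V c N).K →
    ∀ Φinf : 𝓢((Fin 3 → mixedSpace (↥(maximalRealSubfield L))), ℂ),
      lineRepD V c.D (hGR V c) (hGR₀ V c) (hGR₁ V c) (hGR₂ V c) (hGR₃ V c) (η V c) 0
          (HodgeCM.Adelic.regimeEquiv L V.Hm hV
            (UnitaryGroup.finAdelicToAdelic (↥(maximalRealSubfield L)) L (IsCMField.complexConj L) 3 V.Hm kf), 1)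
          (testFun (↥(maximalRealSubfield L)) (Fin 3) Φinf ((𝔄 V c).x₀ 0) N) =
        testFun (↥(maximalRealSubfield L)) (Fin 3) Φinf ((𝔄 V c).x₀ 0) N := by
  intro L ι₁ V c hV _ hc N kf hkf Φinf
  have h₁W := h₁W_SA c hc
  refine hfin_zero_deepLevel V c.D (hGR V c) (hGR₀ V c) (hGR₁ V c) (hGR₂ V c) (hGR₃ V c) (η V c) hV (hηc V c) h₁W ((𝔄 V c).x₀ 0) N
    (finLevelIndex_ne_zero hGR η hηc hGR₀ hGR₁ hGR₂ hGR₃ μ 𝔄 V c N) ?_ kf hkf Φinf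
  rw [finLevelIndex_of_pos hGR η hηc hGR₀ hGR₁ hGR₂ hGR₃ μ 𝔄 V c N h₁W]
  exact dvd_mul_right _ _

/-- **`hfin₁` OF #CA17 § 5 — DISCHARGED.** -/
theorem hfin_one_family :
    ∀ {L : CMField} {ι₁ : L →+* ℂ} (V : HermSpace3 L ι₁) (c : SeesawCtx L) (hV : IsAnisotropic L V.Hm)
      (_hemb : (InfinitePlace.mk ι₁).embedding = ι₁) (_hc : SignRecipe.GoodCtx (orientBitι L ι₁) ι₁ c) (N : ℕ),
    ∀ kf : UnitaryGroup.finAdelic (↥(maximalRealSubfield L)) L (IsCMField.complexConj L) 3 V.Hm,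
      kf ∈ (finLevelFamily hGR η hηc hGR₀ hGR₁ hGR₂ hGR₃ μ 𝔄 V c N).K →
    ∀ Φinf : 𝓢((Fin 3 → mixedSpace (↥(maximalRealSubfield L))), ℂ),
      lineRepD V c.D (hGR V c) (hGR₀ V c) (hGR₁ V c) (hGR₂ V c) (hGR₃ V c) (η V c) 1
          (HodgeCM.Adelic.regimeEquiv L V.Hm hV
            (UnitaryGroup.finAdelicToAdelic (↥(maximalRealSubfield L)) L (IsCMField.complexConj L) 3 V.Hm kf), 1)
          (testFun (↥(maximalRealSubfield L)) (Fin 3) Φinf ((𝔄 V c).x₀ 1) N) =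
        testFun (↥(maximalRealSubfield L)) (Fin 3) Φinf ((𝔄 V c).x₀ 1) N := by
  intro L ι₁ V c hV _ hc N kf hkf Φinf
  have h₁W := h₁W_SA c hc
  refine hfin_one_deepLevel V c.D (hGR V c) (hGR₀ V c) (hGR₁ V c) (hGR₂ V c) (hGR₃ V c) (η V c) hV (hηc V c) ((𝔄 V c).x₀ 1) N
    (finLevelIndex_ne_zero hGR η hηc hGR₀ hGR₁ hGR₂ hGR₃ μ 𝔄 V c N) ?_ kf hkf Φinf
  rw [finLevelIndex_of_pos hGR η hηc hGR₀ hGR₁ hGR₂ hGR₃ μ 𝔄 V c N h₁W]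
  exact dvd_mul_left _ _

end Family

end HodgeCM.Model

end
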